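import Summits.BirchSwinnertonDyer.BirchSwinnertonDyer.Theorems.KimAtThreeFineKatoKPortConsumer
import Literature.NumberTheory.EllipticCurves.SingularCubicCuspCharThreeProofs
import Literature.NumberTheory.LocalFields.UnramifiedGaloisResidueFaithfulProofs
import Literature.NumberTheory.LocalFields.PadicNormedFieldIntegersProofs
import Mathlib.LinearAlgebra.LinearIndependent.Basic
import HarnessLib

/-!
# K-PORT: the RESIDUE-FIELD INPUT `hres` of the consumer theorem, PROVED at `p = 3` —
# `∃ P ∈ E₀(K), N(P) = ∑_σ σP ∉ E₁(K)` for an unramified finite `K ⊇ ℚ₃` at a cuspidal (additive) `M`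
# (cell `bsd-addord`, seat w2-acc4 gen 4; `--supports stmt-BirchSwinnertonDyer-19560`, helper)

HONEST FRAMING. Route W2 (`route-BirchSwinnertonDyer-KimAtThreeKolyvagin`), crux 19560
`KatoKuriharaPortThreeShared`, residual ⟨C1⟩ clause (C1.c) = the E-side of SAT₀ over `K_w`. kport
gen 0 assembled kim3's CONSUMER THEOREM as `KPort.consumer_of_exists_norm_not_mem_kernel` MODULO the
hypothesis `hres : ∃ P ∈ E₀(K), ∑_σ σP ∉ E₁(K)` ("the residue-field statement: reduction
`E₀(K) ↠ Ẽ_ns(k) ≅ k⁺` is onto an element of nonzero `Tr_{k/𝔽₃}`; needs (r1) `reducePoint`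
equivariance, (r2) a `k`-rational cusp chart, (r3) `Gal(K/ℚ₃) ↠ Gal(k/𝔽₃)`, (r4) `𝒪_K`
henselian"). This file PROVES `hres` at `p = 3` in kport's abstract currency with NO instantiation
hypothesis, from three Literature proof files landed for the purpose:
`SingularCubicCuspCharThreeProofs` (r2: over a perfect field of characteristic `3` a cuspidal cubic
has a RATIONAL singular point `(x₀, a₁x₀ + a₃)`, `x₀³ = -b₆`, and `Ẽ_ns(k) ≅ k⁺` by the explicit,
equivariant chart `(x, y) ↦ (x - x₀)/(y - y₀ - a₁(x - x₀))`),
`UnramifiedGaloisResidueFaithfulProofs` (r3 replaced by what is actually needed and PROVABLE: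
`Gal(K/ℚ_p) → Aut(k)` is INJECTIVE for unramified `K`, `p` odd — an elementary contraction
argument) and `PadicNormedFieldIntegersProofs` (r4: `{‖x‖ ≤ 1}` is henselian with finite, perfect
residue field of characteristic `p`, from Mathlib's `IsNonarchimedeanLocalField`).  The argument:
for `σ ∈ Gal(K/ℚ₃)` let `σ̄` be the induced automorphism of `k` (§1); the chart value of the
reduction of `σP` is `σ̄` of that of `P` (§3, (r1) through the explicit formula — no transport of
points); by Dedekind–Artin independence of the DISTINCT characters `σ̄` there is `x ∈ k` with
`∑_σ σ̄ x ≠ 0` (§2); lift `x` to `Q ∈ Ẽ_ns(k)` by the chart and to `P ∈ E₀(K)` by Hensel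
(`reductionHom_surjective`); then the chart value of the reduction of `N(P) = ∑_σ σP ∈ E₀(K)` is
`∑_σ σ̄ x ≠ 0`, so `N(P) ∉ E₁(K) = ker(reduction)` (§4).  §5 feeds this into kport's capstone: the
CONSUMER THEOREM for `W/ℚ` globally minimal with `Addv W 3`, `K/ℚ₃` finite Galois unramified,
now needs no `hres`.  TOOL theorems only (no definition, no named fact, no `sorry`); closes nothing
by itself; nothing booked; BSD is not proved by any of this.  What (C1.c) still needs after this
file is unchanged elsewhere: kim3's (δ) at `ℚ₃`, the `K_w`-instantiation (rescaled norm, (I1) of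
kport's inventory), exp*/[BK90] and the SAT₀ assembly.

## What is proved (`𝒪 = unitBall K`, `k = ResidueField 𝒪`, `W = M.map (coeffHom p K)`,
`E = curveK p K M`, `E₀(K) = W.nonsingularReductionSubgroup hv`, `σP = Affine.Point.map σ P`)

* §1 `exists_residueHom_of_algEquiv` (each `σ` induces `σ̄ : k →+* k` with `σ̄ ā = (σa)‾`),
  `residueHom_residue_coeffHom` (`σ̄` fixes the reductions of the `ℤ_p`-coefficients),
  `exists_residue_ne_of_ne` (`σ ≠ σ'` ⇒ `σ̄ ≠ σ̄'` pointwise somewhere — unramified, `p` odd).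
* §2 `exists_sum_residueHom_ne_zero` (Dedekind–Artin: `∃ x, ∑_σ σ̄ x ≠ 0`).
* §3 `cuspFormula_reducePoint_galois` ((r1): chart ∘ reduction of `σP` = `σ̄` ∘ chart ∘ reduction of
  `P` on `E₀(K)`, `p = 3`).
* §4 **`exists_sum_galois_not_mem_kernel`** = `hres` for any `M/ℤ₃` with `‖Δ‖, ‖c₄‖ < 1` and any
  unramified finite `K ⊇ ℚ₃`; §5 **`consumer_of_addv`** — kport's consumer theorem with `hres`
  discharged (`W/ℚ` globally minimal, `Addv W 3`).

References: Silverman, *AEC* 2nd ed. (2009), III.2.5, VII.2.1–2.2, VII.4 (p. 173) [SilvermanAEC2009];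
kport inventory HOME/kport/KPORT-INVENTORY-g0.md §6–§7; kim3 brief KIM3-KPORT-BRIEF-g12 §3.
-/

noncomputable section

-- the cell's Theorems namespace `Summit.BirchSwinnertonDyer.BirchSwinnertonDyer.…` repeats the summit name by design (D-0017)
set_option linter.dupNamespace false

open scoped Classical

namespace Summit.BirchSwinnertonDyer.BirchSwinnertonDyer.Theorems.KPort

open Summit.BirchSwinnertonDyer.Rank1Residual.Additive
open Summit.BirchSwinnertonDyer.Rank1Residual.Additive.BallEval
open Summit.BirchSwinnertonDyer.Rank1Residual.Additive.LocalLog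
open Literature.NumberTheory.GaloisRepresentations.LubinTate (unitBall mem_unitBall_iff)
open Literature.NumberTheory.EllipticCurves Literature.NumberTheory.EllipticCurves.FormalGroupChart
open Literature.NumberTheory.EllipticCurves.Rank1Residual
open Literature.NumberTheory.LocalFields WeierstrassCurve IsLocalRing

section GeneralPrime

variable {p : ℕ} [hp : Fact p.Prime] {K : Type*} [NontriviallyNormedField K] [NormedAlgebra ℚ_[p] K]
  [IsUltrametricDist K]

/-! ## §1 The automorphism `σ̄` of the residue field induced by `σ ∈ Gal(K/ℚ_p)` -/

section ResidueHom

omit hp [NormedAlgebra ℚ_[p] K] in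
/-- An element of `𝒪_K` of norm `1` is a unit. [folklore] -/
private theorem isUnit_of_norm_eq_one {a : unitBall K} (h : ‖(a : K)‖ = 1) : IsUnit a := by
  refine Valuation.Integers.isUnit_of_one
    (Valuation.integer.integers (NormedField.valuation (K := K))) ?_ ?_
  · exact isUnit_iff_ne_zero.mpr (norm_pos_iff.mp (by change 0 < ‖(a : K)‖; rw [h]; exact one_pos))
  · change NormedField.valuation (a : K) = 1
    rw [← NNReal.coe_inj, NormedField.valuation_apply, coe_nnnorm, h, NNReal.coe_one]

omit hp [NormedAlgebra ℚ_[p] K] in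
/-- A unit of `𝒪_K` has norm `1`. [folklore] -/
private theorem norm_eq_one_of_isUnit {a : unitBall K} (h : IsUnit a) : ‖(a : K)‖ = 1 := by
  have h1 := Valuation.Integers.one_of_isUnit
    (Valuation.integer.integers (NormedField.valuation (K := K))) h
  rw [← NNReal.coe_inj, NormedField.valuation_apply, coe_nnnorm, NNReal.coe_one] at h1
  exact h1

/-- **`σ ∈ Gal(K/ℚ_p)` induces `σ̄ : k →+* k` on the residue field** `k = 𝒪_K/𝔪_K` (`σ` is an
isometry, so it preserves `𝒪_K = {‖x‖ ≤ 1}` and its units): there is a ring endomorphism `τ` of `k`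
with `τ ā = (σ a)‾` for every `a ∈ 𝒪_K`.  Stated as an existence so that no definition is needed;
the membership `σ a ∈ 𝒪_K` is quantified. [cite: SilvermanAEC2009, VII.4 (p. 173)] -/
theorem exists_residueHom_of_algEquiv [Algebra.IsAlgebraic ℚ_[p] K] (σ : K ≃ₐ[ℚ_[p]] K) :
    ∃ τ : ResidueField (unitBall K) →+* ResidueField (unitBall K),
      ∀ (a : unitBall K) (ha : σ (a : K) ∈ unitBall K), τ (residue _ a) = residue _ ⟨σ a, ha⟩ := by
  have hmem : ∀ x ∈ unitBall K, (σ : K →+* K) x ∈ unitBall K := fun x hx => by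
    rw [mem_unitBall_iff] at hx ⊢
    change ‖σ x‖ ≤ 1
    rwa [norm_algEquiv_eq]
  set σ𝒪 : unitBall K →+* unitBall K := (σ : K →+* K).restrict (unitBall K) (unitBall K) hmem
    with hσ𝒪
  haveI : IsLocalHom σ𝒪 := by
    refine ⟨fun a ha => isUnit_of_norm_eq_one ?_⟩
    have h1 := norm_eq_one_of_isUnit ha
    change ‖σ (a : K)‖ = 1 at h1
    rwa [norm_algEquiv_eq] at h1
  refine ⟨ResidueField.map σ𝒪, fun a ha => ?_⟩
  rw [ResidueField.map_residue]
  rfl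

/-- `σ̄` FIXES the reductions of `ℤ_p`-coefficients: `σ̄ (c̄) = c̄` for `c = coeffHom p K c₀`
(`σ` commutes with `algebraMap ℚ_p K`). [folklore] -/
theorem residueHom_residue_coeffHom (σ : K ≃ₐ[ℚ_[p]] K)
    {τ : ResidueField (unitBall K) →+* ResidueField (unitBall K)}
    (hτ : ∀ (a : unitBall K) (ha : σ (a : K) ∈ unitBall K), τ (residue _ a) = residue _ ⟨σ a, ha⟩)
    (c : ℤ_[p]) : τ (residue _ (coeffHom p K c)) = residue _ (coeffHom p K c) := by
  have hc : σ ((coeffHom p K c : unitBall K) : K) = (coeffHom p K c : K) := by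
    rw [coe_coeffHom, AlgEquiv.commutes]
  have hmem : σ ((coeffHom p K c : unitBall K) : K) ∈ unitBall K := by
    rw [hc]; exact (coeffHom p K c).2
  rw [hτ _ hmem]
  congr 1
  exact Subtype.ext hc

variable [FiniteDimensional ℚ_[p] K]

/-- **Distinct automorphisms have distinct residue maps** (unramified `K`, `p` odd): for `σ ≠ σ'`
there is `a ∈ 𝒪_K` with `(σ a)‾ ≠ (σ' a)‾` — `Gal(K/ℚ_p)` acts FAITHFULLY on the residue field
(tree `exists_norm_sub_eq_one_of_ne_one` applied to `σ'⁻¹σ`, plus the isometry of `σ'`).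
[cite: SilvermanAEC2009, VII.4 (p. 173)] -/
theorem exists_residue_ne_of_ne (hp2 : p ≠ 2) (hK : ∀ x : K, ‖x‖ < 1 → ‖x‖ ≤ ‖(p : K)‖)
    {σ σ' : K ≃ₐ[ℚ_[p]] K} (hne : σ ≠ σ')
    {τ τ' : ResidueField (unitBall K) →+* ResidueField (unitBall K)}
    (hτ : ∀ (a : unitBall K) (ha : σ (a : K) ∈ unitBall K), τ (residue _ a) = residue _ ⟨σ a, ha⟩)
    (hτ' : ∀ (a : unitBall K) (ha : σ' (a : K) ∈ unitBall K), τ' (residue _ a) = residue _ ⟨σ' a, ha⟩) :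
    ∃ z : ResidueField (unitBall K), τ z ≠ τ' z := by
  have hρ : σ.trans σ'.symm ≠ 1 := by
    intro h
    apply hne
    ext x
    have hx : (σ.trans σ'.symm) x = x := by rw [h, AlgEquiv.one_apply]
    rw [AlgEquiv.trans_apply] at hx
    simpa using congrArg σ' hx
  obtain ⟨y, hy1, hy⟩ := exists_norm_sub_eq_one_of_ne_one hp2 hK hρ
  -- `‖σ y - σ' y‖ = ‖σ' (σ'⁻¹ σ y - y)‖ = 1`
  have hdiff : ‖σ y - σ' y‖ = 1 := by
    have e : σ y - σ' y = σ' ((σ.trans σ'.symm) y - y) := by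
      rw [map_sub, AlgEquiv.trans_apply, AlgEquiv.apply_symm_apply]
    rw [e, norm_algEquiv_eq, hy]
  have hyσ : σ y ∈ unitBall K := by rw [mem_unitBall_iff, norm_algEquiv_eq]; exact hy1
  have hyσ' : σ' y ∈ unitBall K := by rw [mem_unitBall_iff, norm_algEquiv_eq]; exact hy1
  refine ⟨residue _ ⟨y, (mem_unitBall_iff K).mpr hy1⟩, ?_⟩
  rw [hτ _ hyσ, hτ' _ hyσ', Ne, ← sub_eq_zero, ← map_sub, residue_eq_zero_iff, mem_maximalIdeal,
    mem_nonunits_iff, not_not]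
  exact isUnit_of_norm_eq_one hdiff

end ResidueHom

/-! ## §2 Dedekind–Artin: some residue class has `∑_σ σ̄ x ≠ 0` -/

section Artin

variable [FiniteDimensional ℚ_[p] K]

/-- **`∃ x ∈ k, ∑_{σ ∈ Gal(K/ℚ_p)} σ̄ x ≠ 0`** (unramified `K`, `p` odd).  The residue maps `σ̄` are
pairwise DISTINCT ring endomorphisms of the field `k` (§1), hence linearly independent over `k`
(Dedekind–Artin, Mathlib `linearIndependent_monoidHom`); in particular their sum is not the zero
function. [cite: SilvermanAEC2009, VII.4 (p. 173)] -/
theorem exists_sum_residueHom_ne_zero (hp2 : p ≠ 2) (hK : ∀ x : K, ‖x‖ < 1 → ‖x‖ ≤ ‖(p : K)‖)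
    (τ : (K ≃ₐ[ℚ_[p]] K) → (ResidueField (unitBall K) →+* ResidueField (unitBall K)))
    (hτ : ∀ (σ : K ≃ₐ[ℚ_[p]] K) (a : unitBall K) (ha : σ (a : K) ∈ unitBall K),
      τ σ (residue _ a) = residue _ ⟨σ a, ha⟩) :
    ∃ x : ResidueField (unitBall K), ∑ σ : K ≃ₐ[ℚ_[p]] K, τ σ x ≠ 0 := by
  set k := ResidueField (unitBall K)
  set φ : (K ≃ₐ[ℚ_[p]] K) → (k →* k) := fun σ => (τ σ : k →* k) with hφ_def
  have hφ : Function.Injective φ := by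
    intro σ σ' h
    by_contra hne
    obtain ⟨z, hz⟩ := exists_residue_ne_of_ne hp2 hK hne (hτ σ) (hτ σ')
    exact hz (by simpa [hφ_def] using DFunLike.congr_fun h z)
  have hli := (linearIndependent_monoidHom k k).comp φ hφ
  have hsum : (∑ σ : K ≃ₐ[ℚ_[p]] K, (1 : k) • (((fun f : k →* k => (f : k → k)) ∘ φ) σ)) ≠ 0 :=
    fun h0 => one_ne_zero (Fintype.linearIndependent_iff.mp hli (fun _ => 1) h0 1)
  obtain ⟨x, hx⟩ := Function.ne_iff.mp hsum
  refine ⟨x, ?_⟩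
  simpa [Finset.sum_apply, Pi.smul_apply, hφ_def] using hx

end Artin

/-! ## §3 (r1) The cusp chart of the reduction is Galois-equivariant -/

section Equivariance

variable {M : WeierstrassCurve ℤ_[p]} [Algebra.IsAlgebraic ℚ_[p] K]

/-- **`chart(σP̃) = σ̄ (chart P̃)` on `E₀(K)`** — reduction commutes with Galois
(Silverman, proof of VII.4.1: `\widetilde{P^σ} = \tilde P^σ`), expressed through an additive chart
`r : Ẽ_ns(k) → k` given on affine points by the cusp formula `(x, y) ↦ (x - x₀)/(y - y₀ - a₁(x - x₀))`
with a `σ̄`-fixed base point `x₀` (no transport of points between curves is needed: integral points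
reduce coordinatewise, non-integral points and `O` reduce to `Õ`).
[cite: SilvermanAEC2009, VII.4 proof of Prop. 4.1 (p. 174)] -/
theorem cuspFormula_reducePoint_galois (σ : K ≃ₐ[ℚ_[p]] K)
    {τ : ResidueField (unitBall K) →+* ResidueField (unitBall K)}
    (hτ : ∀ (a : unitBall K) (ha : σ (a : K) ∈ unitBall K), τ (residue _ a) = residue _ ⟨σ a, ha⟩)
    {x₀ : ResidueField (unitBall K)} (hx₀ : τ x₀ = x₀)
    {r : ((M.map (coeffHom p K)).map (residue (unitBall K))).toAffine.Point →+
      ResidueField (unitBall K)}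
    (hr : ∀ {x y : ResidueField (unitBall K)}
      (h : ((M.map (coeffHom p K)).map (residue (unitBall K))).toAffine.Nonsingular x y),
      r (.some x y h) = (x - x₀) / (y - (((M.map (coeffHom p K)).map (residue (unitBall K))).a₁ * x₀ +
        ((M.map (coeffHom p K)).map (residue (unitBall K))).a₃) -
        ((M.map (coeffHom p K)).map (residue (unitBall K))).a₁ * (x - x₀)))
    {P : (curveK p K M).toAffine.Point}
    (hP : P ∈ (M.map (coeffHom p K)).nonsingularReductionSubgroup
      (Valuation.integer.integers (NormedField.valuation (K := K)))) :
    r ((M.map (coeffHom p K)).reducePoint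
        (Affine.Point.map (W' := (M.map PadicInt.Coe.ringHom).toAffine) (σ : K →ₐ[ℚ_[p]] K) P)) =
      τ (r ((M.map (coeffHom p K)).reducePoint P)) := by
  set hv := Valuation.integer.integers (NormedField.valuation (K := K)) with hv_def
  have h₁ : τ ((M.map (coeffHom p K)).map (residue (unitBall K))).a₁ =
      ((M.map (coeffHom p K)).map (residue (unitBall K))).a₁ :=
    residueHom_residue_coeffHom σ hτ M.a₁
  have h₃ : τ ((M.map (coeffHom p K)).map (residue (unitBall K))).a₃ =
      ((M.map (coeffHom p K)).map (residue (unitBall K))).a₃ :=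
    residueHom_residue_coeffHom σ hτ M.a₃
  rcases point_cases (W := M.map (coeffHom p K)) hv P with rfl | ⟨x, y, hxy, rfl, hx1⟩ | ⟨a, b, hab, rfl⟩
  · -- `P = O`
    change r ((M.map (coeffHom p K)).reducePoint 0) = τ (r ((M.map (coeffHom p K)).reducePoint 0))
    rw [WeierstrassCurve.reducePoint_zero, map_zero, map_zero]
  · -- `P = (x, y)` with `‖x‖ > 1`: both `P` and `σP` reduce to `Õ`
    have hx1' : 1 < NormedField.valuation (K := K) (σ x) := by
      rw [one_lt_normedValuation_iff, norm_algEquiv_eq]; exact (one_lt_normedValuation_iff x).mp hx1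
    rw [WeierstrassCurve.reducePoint_some_of_not_mem hxy
      ((Literature.NumberTheory.EllipticCurves.not_mem_range_iff hv).mpr hx1)]
    change r ((M.map (coeffHom p K)).reducePoint (.some (σ x) (σ y) _)) = _
    rw [WeierstrassCurve.reducePoint_some_of_not_mem _
      ((Literature.NumberTheory.EllipticCurves.not_mem_range_iff hv).mpr hx1'), map_zero, map_zero]
  · -- integral point: reduce coordinatewise
    have hns := (WeierstrassCurve.hasNonsingularReduction_some_algebraMap_iff hv.hom_inj hab).mp hP
    have ha' : σ (a : K) ∈ unitBall K := by rw [mem_unitBall_iff, norm_algEquiv_eq]; exact a.2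
    have hb' : σ (b : K) ∈ unitBall K := by rw [mem_unitBall_iff, norm_algEquiv_eq]; exact b.2
    obtain ⟨hab', e⟩ : ∃ h' : ((M.map (coeffHom p K)).baseChange K).toAffine.Nonsingular
        (algebraMap (unitBall K) K ⟨σ a, ha'⟩) (algebraMap (unitBall K) K ⟨σ b, hb'⟩),
        Affine.Point.map (W' := (M.map PadicInt.Coe.ringHom).toAffine) (σ : K →ₐ[ℚ_[p]] K)
          (Affine.Point.some _ _ hab : (curveK p K M).toAffine.Point) =
        (Affine.Point.some _ _ h' : (curveK p K M).toAffine.Point) :=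
      ⟨_, rfl⟩
    have hσP := (galois_mem_nonsingularReductionSubgroup_iff σ
      (Affine.Point.some _ _ hab : (curveK p K M).toAffine.Point)).mpr hP
    rw [e] at hσP
    have hns' := (WeierstrassCurve.hasNonsingularReduction_some_algebraMap_iff hv.hom_inj hab').mp hσP
    change r ((M.map (coeffHom p K)).reducePoint (Affine.Point.some _ _ hab')) = _
    rw [WeierstrassCurve.reducePoint_some_algebraMap hv.hom_inj hab' hns',
      WeierstrassCurve.reducePoint_some_algebraMap hv.hom_inj hab hns,
      hr, hr, cuspChart_map_of_fixed _ τ h₁ h₃ hx₀, ← hτ a ha', ← hτ b hb']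

end Equivariance

end GeneralPrime

/-! ## §4 `hres` at `p = 3`: some `P ∈ E₀(K)` has `N(P) ∉ E₁(K)` -/

section Three

variable {K : Type*} [NontriviallyNormedField K] [NormedAlgebra ℚ_[3] K] [IsUltrametricDist K]
  [FiniteDimensional ℚ_[3] K]

/-- **The residue-field input `hres` of the consumer theorem, PROVED (`p = 3`).**  Let `K ⊇ ℚ₃` be a
normed `ℚ₃`-algebra field, ultrametric, finite-dimensional, UNRAMIFIED (`‖x‖ < 1 → ‖x‖ ≤ ‖3‖`),
and `M/ℤ₃` a Weierstrass model with `‖Δ‖ < 1`, `‖c₄‖ < 1` (cuspidal reduction).  Then some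
`P ∈ E₀(K)` has `N(P) = ∑_{σ ∈ Aut(K/ℚ₃)} σP ∉ E₁(K)`.  Proof: `𝒪_K` is henselian with finite perfect
residue field `k` of characteristic `3`; `Ẽ_ns(k) ≅ k⁺` by the rational cusp chart `r`; the residue
maps `σ̄` are distinct, so `∑_σ σ̄ x ≠ 0` for some `x` (Dedekind–Artin); lift `r⁻¹ x` to `P ∈ E₀(K)`
(Hensel); `r` of the reduction of `N(P)` is `∑_σ σ̄ x ≠ 0`, while points of `E₁(K)` reduce to `Õ`.
[cite: SilvermanAEC2009, VII.2 Prop. 2.1, III.2.5 and VII.4 (pp. 167, 56, 173)] -/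
theorem exists_sum_galois_not_mem_kernel {M : WeierstrassCurve ℤ_[3]}
    (hK : ∀ x : K, ‖x‖ < 1 → ‖x‖ ≤ ‖(3 : K)‖)
    [(curveK 3 K M).IsIntegral (NormedField.valuation (K := K)).integer]
    (hΔ : ‖M.Δ‖ < 1) (hc₄ : ‖M.c₄‖ < 1) :
    ∃ P ∈ (M.map (coeffHom 3 K)).nonsingularReductionSubgroup
        (Valuation.integer.integers (NormedField.valuation (K := K))),
      (∑ σ : K ≃ₐ[ℚ_[3]] K, Affine.Point.map (W' := (M.map PadicInt.Coe.ringHom).toAffine)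
          (σ : K →ₐ[ℚ_[3]] K) P) ∉
        kernel (NormedField.valuation (K := K)) (curveK 3 K M) := by
  set hv := Valuation.integer.integers (NormedField.valuation (K := K)) with hv_def
  haveI : HenselianRing (unitBall K) (maximalIdeal (unitBall K)) :=
    henselianRing_maximalIdeal_integer_of_finiteDimensional_padic 3 K
  haveI : CharP (ResidueField (unitBall K)) 3 := charP_residueField_integer 3 K
  haveI : PerfectRing (ResidueField (unitBall K)) 3 :=
    perfectRing_residueField_integer_of_finiteDimensional_padic 3 K
  haveI : Algebra.IsAlgebraic ℚ_[3] K := Algebra.IsAlgebraic.of_finite ℚ_[3] K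
  -- the reduced curve is cuspidal
  have hΔk : ((M.map (coeffHom 3 K)).map (residue (unitBall K))).Δ = 0 := by
    rw [map_Δ]; exact residue_Δ_map_coeffHom_eq_zero hΔ
  have hc₄k : ((M.map (coeffHom 3 K)).map (residue (unitBall K))).c₄ = 0 := by
    rw [map_c₄]; exact residue_c₄_map_coeffHom_eq_zero hc₄
  -- the rational cusp chart `r : Ẽ_ns(k) ≅ k⁺`
  obtain ⟨x₀, hx₀, r, hr, hrf⟩ :=
    ((M.map (coeffHom 3 K)).map (residue (unitBall K))).exists_addMonoidHom_bijective_of_cusp_of_perfectRing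
      hc₄k hΔk
  -- the residue maps `σ̄`, fixing the coefficients and the base point `x₀`
  choose τ hτ using fun σ : K ≃ₐ[ℚ_[3]] K => exists_residueHom_of_algEquiv σ
  have hτx₀ : ∀ σ : K ≃ₐ[ℚ_[3]] K, τ σ x₀ = x₀ := fun σ =>
    cubeRoot_fixed_of_char_three _ (τ σ) (residueHom_residue_coeffHom σ (hτ σ) M.a₃)
      (residueHom_residue_coeffHom σ (hτ σ) M.a₆) hx₀
  -- Dedekind–Artin
  obtain ⟨x, hx⟩ := exists_sum_residueHom_ne_zero (by norm_num) hK τ hτ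
  -- lift `x` to `Q ∈ Ẽ_ns(k)` and to `P ∈ E₀(K)` (Hensel)
  obtain ⟨Q, hQ⟩ := hr.2 x
  obtain ⟨P, hP⟩ := (M.map (coeffHom 3 K)).reductionHom_surjective hv Q
  refine ⟨P.1, P.2, fun hN => hx ?_⟩
  have hσ : ∀ σ : K ≃ₐ[ℚ_[3]] K,
      Affine.Point.map (W' := (M.map PadicInt.Coe.ringHom).toAffine) (σ : K →ₐ[ℚ_[3]] K)
          P.1 ∈
        (M.map (coeffHom 3 K)).nonsingularReductionSubgroup hv :=
    fun σ => (galois_mem_nonsingularReductionSubgroup_iff σ _).mpr P.2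
  -- the norm as an element `S` of `E₀(K)`
  set S : (M.map (coeffHom 3 K)).nonsingularReductionSubgroup hv := ∑ σ : K ≃ₐ[ℚ_[3]] K, ⟨_, hσ σ⟩
    with hS
  have hSval : S.1 =
      ∑ σ : K ≃ₐ[ℚ_[3]] K, Affine.Point.map (W' := (M.map PadicInt.Coe.ringHom).toAffine)
        (σ : K →ₐ[ℚ_[3]] K) P.1 := by
    rw [hS, AddSubmonoidClass.coe_finsetSum]
    rfl
  -- chart ∘ reduction of `S` is `∑_σ σ̄ x`
  have key : r ((M.map (coeffHom 3 K)).reductionHom hv S) = ∑ σ : K ≃ₐ[ℚ_[3]] K, τ σ x := by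
    rw [hS, map_sum, map_sum]
    refine Finset.sum_congr rfl fun σ _ => ?_
    rw [reductionHom_apply]
    change r ((M.map (coeffHom 3 K)).reducePoint
      (Affine.Point.map (W' := (M.map PadicInt.Coe.ringHom).toAffine) (σ : K →ₐ[ℚ_[3]] K)
        P.1)) = _
    rw [cuspFormula_reducePoint_galois σ (hτ σ) (hτx₀ σ) hrf P.2, ← reductionHom_apply, hP, hQ]
  -- … but `S` reduces to `Õ` since its value lies in `E₁(K)`
  have h0 : (M.map (coeffHom 3 K)).reductionHom hv S = 0 := by
    rw [reductionHom_apply, hSval]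
    exact ((mem_kernel_iff_reducesToZero_curveK _).mp hN).reducePoint_eq_zero
  rw [← key, h0, map_zero]

/-! ## §5 The consumer theorem with `hres` discharged -/

/-- **kim3's CONSUMER THEOREM for SAT₀'s E-side, `hres`-free (`p = 3`).**  `W/ℚ` globally minimal
with additive reduction at `3` (`Addv W 3`), `K/ℚ₃` finite Galois, complete ultrametric, unramified
(`hK`): (a) some `P ∈ E₀(K)` and `P₀ ∈ E₀(ℚ₃) ∖ E₁(ℚ₃)` have `ι P₀ = N(P)` and
`Tr_{K/ℚ₃}(Λ̃ P) = padicLog X P₀`; (b) `‖Λ̃ Q‖ ≤ 1` on `E₀(K)`.  This is kport's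
`consumer_of_exists_norm_not_mem_kernel` with its residue-field hypothesis supplied by
`exists_sum_galois_not_mem_kernel`; what remains MODULO for the E-side of SAT₀ is kim3's own (δ) at
`ℚ₃` (turning `P₀ ∈ E₀ ∖ E₁` into `padicLog X P₀ ∈ ℤ₃ˣ` on the Kato stratum).
[cite: SilvermanAEC2009, IV.6.4, VII.2 Prop. 2.1–2.2, III.2.5, VII.4] -/
theorem consumer_of_addv [CompleteSpace K] [IsGalois ℚ_[3] K]
    (W : WeierstrassCurve ℚ) [W.IsElliptic] [W.IsGloballyMinimal]
    [hint : (curveK 3 K ((integralModelInt W).map (Int.castRingHom ℤ_[3]))).IsIntegral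
      (NormedField.valuation (K := K)).integer]
    [hE : (((integralModelInt W).map (Int.castRingHom ℤ_[3])).map PadicInt.Coe.ringHom).IsElliptic]
    [hX : (((integralModelInt W).map (Int.castRingHom ℤ_[3])).map PadicInt.Coe.ringHom).IsIntegral ℤ_[3]]
    [hX' : (((integralModelInt W).map (Int.castRingHom ℤ_[3])).map PadicInt.Coe.ringHom).IsIntegral
      (NormedField.valuation (K := ℚ_[3])).integer]
    [hmin : (((integralModelInt W).map (Int.castRingHom ℤ_[3])).map PadicInt.Coe.ringHom).IsMinimal ℤ_[3]]
    (hadd : Addv W 3) (hK : ∀ x : K, ‖x‖ < 1 → ‖x‖ ≤ ‖((3 : ℕ) : K)‖) :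
    (∃ P ∈ (((integralModelInt W).map (Int.castRingHom ℤ_[3])).map (coeffHom 3 K)).nonsingularReductionSubgroup
        (Valuation.integer.integers (NormedField.valuation (K := K))),
      ∃ P₀ : (((integralModelInt W).map (Int.castRingHom ℤ_[3])).map PadicInt.Coe.ringHom).toAffine.Point,
        P₀ ∈ (((integralModelInt W).map (Int.castRingHom ℤ_[3])).map PadicInt.Coe.ringHom).goodReductionSubgroup
            ℤ_[3] ∧
          ¬ (((integralModelInt W).map (Int.castRingHom ℤ_[3])).map PadicInt.Coe.ringHom).IsInReductionKernel P₀ ∧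
          Affine.Point.map
              (W' := (((integralModelInt W).map (Int.castRingHom ℤ_[3])).map PadicInt.Coe.ringHom).toAffine)
              (Algebra.ofId ℚ_[3] K) P₀ =
            ∑ σ : K ≃ₐ[ℚ_[3]] K, Affine.Point.map
              (W' := (((integralModelInt W).map (Int.castRingHom ℤ_[3])).map PadicInt.Coe.ringHom).toAffine)
              (σ : K →ₐ[ℚ_[3]] K) P ∧
          Algebra.trace ℚ_[3] K (satLog 3 K ((integralModelInt W).map (Int.castRingHom ℤ_[3])) P) =
            padicLog (((integralModelInt W).map (Int.castRingHom ℤ_[3])).map PadicInt.Coe.ringHom) P₀) ∧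
    ∀ Q ∈ (((integralModelInt W).map (Int.castRingHom ℤ_[3])).map (coeffHom 3 K)).nonsingularReductionSubgroup
        (Valuation.integer.integers (NormedField.valuation (K := K))),
      ‖satLog 3 K ((integralModelInt W).map (Int.castRingHom ℤ_[3])) Q‖ ≤ 1 := by
  have hK' : ∀ x : K, ‖x‖ < 1 → ‖x‖ ≤ ‖(3 : K)‖ := by simpa using hK
  exact consumer_of_exists_norm_not_mem_kernel W hadd hK
    (exists_sum_galois_not_mem_kernel hK' (norm_Δ_lt_one_of_addv W hadd).1
      (norm_Δ_lt_one_of_addv W hadd).2)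

end Three

end Summit.BirchSwinnertonDyer.BirchSwinnertonDyer.Theorems.KPort

end
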